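import Literature.MathematicalPhysics.QuantumFieldTheory.ConformalBootstrap3D.MixedEvenTail
import Literature.MathematicalPhysics.QuantumFieldTheory.ConformalBootstrap3D.PointCertificateTableLower

/-!
# Even-sector light-block cells of a mixed `σ–ε` point certificate

The `ℤ₂`-even obligation of `MixedObligations` at `(Δ, ℓ)` is a `2 × 2` condition: for every
`(a, b)`, `Σ_{(n,j)} (A_{n,j}(Δ,ℓ)/λ_ℓ) q_{Δ+n,j}(a,b) ≥ 0` with the term forms
`q_{E,j}(a,b) = a² Φ¹(E,j,Δ_σ) + b² Φ²(E,j,Δ_ε) + ab Φ⁴⁵(E,j,s)`, `s = (Δ_σ+Δ_ε)/2`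
(`evenTermForm`, `hasSum_evenForm_ofPoints`; ONE Hogervorst–Rychkov array `A ≥ 0` for all three
entries since every even row carries the same block `g^{0,0}_{Δ,ℓ}`). `MixedEvenTail` closes the tail
`Δ ≥ E₀` termwise ((M) boxes by `evenTermForm_nonneg_of_cornerBounds`, (T) by the two-sided apex
estimate). This file closes the LIGHT even blocks — (E2) `ε` at `(Δ_ε, 0)`, (E3) scalars on `[3, E₀)`,
(E4) even spins on `[ℓ+1, E₀)` — by HEAD CELLS: on a `Δ`-cell `[a, b)` the head quadratic form
`x² X(Δ) + y² Y(Δ) + xy Z(Δ)`, `X = Σ_F (A/λ)Φ¹`, `Y = Σ_F (A/λ)Φ²`, `Z = Σ_F (A/λ)Φ⁴⁵`, is PSD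
uniformly on the cell as soon as three finite sums of table numbers satisfy
`X_lo ≥ 0`, `Y_lo ≥ 0`, `Z_abs² ≤ 4 X_lo Y_lo` (`evenHeadNumbersOK`), where
`X_lo = Σ_F min(Lo Φ¹lo, Hi Φ¹lo)`, `Y_lo = Σ_F min(Lo Φ²lo, Hi Φ²lo)` (`headCellSumI` with the
interval coefficient tables `hrCoeffLo/Hi a b ℓ` and corner term bounds) and
`Z_abs = Σ_F Hi · max(|zm|, |zp|)` with the two-weight corner bounds `zm ≤ Φ⁴⁵ ≤ -zp`
(`cornerBound₂ (w⁴+w⁵) (w⁴-w⁵)`, `cornerBound₂ (-(w⁴+w⁵)) (-(w⁴-w⁵))`) — the worst case of a `2 × 2`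
symmetric interval matrix is (minimal diagonal, maximal `|off-diagonal|`). Terms off the head set lie
in the tail domain where (M)/(T) apply. One cell ⇒ `EvenPositive` for every `(Δ_σ,Δ_ε) ∈ Q` at every
`Δ ∈ [a, b)` (`evenCell_of_headNumbers`; non-regular points by right limits inside the cell); cell
lists glue by `evenPositive_of_cells`. With `MixedOddTail`/`MixedOddHead` every obligation of an
island certificate except the functional's own numbers is now a closed-form table check.
[cite: KosPolandSimmonsduffin2014, §3.3 eq. (3.16)]
-/

noncomputable section

namespace Literature.MathematicalPhysics.QuantumFieldTheory.ConformalBootstrap3D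

open Finset Set Filter Topology

/-! ### The head quadratic form -/

/-- The upper head sum for the off-diagonal entry: `Σ_{(n,j) ∈ F} Hi_{n,j} · Zabs_{n,j}`.
[cite: HogervorstRychkov2013, §3 eq. (3.9)] -/
def headAbsSumI (ℓ : ℕ) (a b : ℝ) (F : Finset (ℕ × ℕ)) (Zabs : ℕ × ℕ → ℝ) : ℝ :=
  ∑ q ∈ F, hrCoeffHi a b ℓ q.1 q.2 * Zabs q

/-- The head sum of the term forms splits into the three entry sums. [folklore] -/
theorem sum_evenTermForm_eq {N : ℕ} (z zb : Fin N → ℝ) (w : Fin 5 → Fin N → ℝ) (Δσ Δε Δ : ℝ)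
    (F : Finset (ℕ × ℕ)) (c : ℕ × ℕ → ℝ) (x y : ℝ) :
    ∑ q ∈ F, c q * evenTermForm z zb w Δσ Δε (Δ + (q.1 : ℝ)) q.2 x y =
      x ^ 2 * ∑ q ∈ F, c q * pointFunctional (w 0) z zb (crossF Δσ (-1) (zMono (Δ + (q.1 : ℝ)) q.2)) +
      y ^ 2 * ∑ q ∈ F, c q * pointFunctional (w 1) z zb (crossF Δε (-1) (zMono (Δ + (q.1 : ℝ)) q.2)) +
      x * y * ∑ q ∈ F, c q *
        (pointFunctional (w 3) z zb (crossF ((Δσ + Δε) / 2) (-1) (zMono (Δ + (q.1 : ℝ)) q.2)) +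
          pointFunctional (w 4) z zb (crossF ((Δσ + Δε) / 2) 1 (zMono (Δ + (q.1 : ℝ)) q.2))) := by
  simp only [evenTermForm, Finset.mul_sum, ← Finset.sum_add_distrib]
  exact Finset.sum_congr rfl fun q _ => by ring

/-- **Even head cell rule, regular points.** Cell `[a, b]` starting strictly above the unitarity
bound; `Φ¹lo, Φ²lo` bound the diagonal head terms from below and `Zabs` the off-diagonal head terms in
absolute value, uniformly on the cell; the three numbers satisfy `X_lo ≥ 0`, `Y_lo ≥ 0`,
`Z_abs² ≤ 4 X_lo Y_lo`; every term form off `F` on the descendant range is PSD for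
`E ∈ [a+n, b+n]`. Then `EvenPositive` at every REGULAR `Δ ∈ [a, b]`.
[cite: KosPolandSimmonsduffin2014, §3.3 eq. (3.16)] -/
theorem evenPositive_ofPoints_of_headSumsI {N : ℕ} (z zb : Fin N → ℝ) (w : Fin 5 → Fin N → ℝ)
    (hz : ∀ k, z k ∈ Ioo (0 : ℝ) 1) (hzb : ∀ k, zb k ∈ Ioo (0 : ℝ) 1) {ℓ : ℕ} {a b Δσ Δε : ℝ}
    (ha : unitarityBound3D ℓ < a) (F : Finset (ℕ × ℕ)) (Φ₁lo Φ₂lo Zabs : ℕ × ℕ → ℝ)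
    (hΦ₁ : ∀ q ∈ F, ∀ Δ ∈ Icc a b,
      Φ₁lo q ≤ pointFunctional (w 0) z zb (crossF Δσ (-1) (zMono (Δ + (q.1 : ℝ)) q.2)))
    (hΦ₂ : ∀ q ∈ F, ∀ Δ ∈ Icc a b,
      Φ₂lo q ≤ pointFunctional (w 1) z zb (crossF Δε (-1) (zMono (Δ + (q.1 : ℝ)) q.2)))
    (hZ : ∀ q ∈ F, ∀ Δ ∈ Icc a b,
      |pointFunctional (w 3) z zb (crossF ((Δσ + Δε) / 2) (-1) (zMono (Δ + (q.1 : ℝ)) q.2)) +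
        pointFunctional (w 4) z zb (crossF ((Δσ + Δε) / 2) 1 (zMono (Δ + (q.1 : ℝ)) q.2))| ≤ Zabs q)
    (hX : 0 ≤ headCellSumI ℓ a b F Φ₁lo) (hY : 0 ≤ headCellSumI ℓ a b F Φ₂lo)
    (hdet : headAbsSumI ℓ a b F Zabs ^ 2 ≤ 4 * headCellSumI ℓ a b F Φ₁lo * headCellSumI ℓ a b F Φ₂lo)
    (htail : ∀ q : ℕ × ℕ, q ∉ F → InDescendantRange ℓ q.1 q.2 →
      ∀ E ∈ Icc (a + q.1) (b + q.1), ∀ x y : ℝ, 0 ≤ evenTermForm z zb w Δσ Δε E q.2 x y) :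
    ∀ Δ ∈ Icc a b, IsRegularPoint3D Δ ℓ →
      (CrossingFunctional.ofPoints z zb w).EvenPositive Δσ Δε Δ ℓ := by
  intro Δ hΔ hreg
  have hlt : unitarityBound3D ℓ < Δ := lt_of_lt_of_le ha hΔ.1
  have hlam : 0 < legendreLam ℓ := legendreLam_pos ℓ
  refine evenPositive_ofPoints_of_termwise z zb w hz hzb hlt hreg.2 F ?_ ?_
  · intro x y
    rw [sum_evenTermForm_eq]
    set c : ℕ × ℕ → ℝ := fun q => hrCoeff Δ ℓ q.1 q.2 / legendreLam ℓ with hc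
    set X := ∑ q ∈ F, c q * pointFunctional (w 0) z zb (crossF Δσ (-1) (zMono (Δ + (q.1 : ℝ)) q.2))
    set Y := ∑ q ∈ F, c q * pointFunctional (w 1) z zb (crossF Δε (-1) (zMono (Δ + (q.1 : ℝ)) q.2))
    set W := ∑ q ∈ F, c q *
        (pointFunctional (w 3) z zb (crossF ((Δσ + Δε) / 2) (-1) (zMono (Δ + (q.1 : ℝ)) q.2)) +
          pointFunctional (w 4) z zb (crossF ((Δσ + Δε) / 2) 1 (zMono (Δ + (q.1 : ℝ)) q.2)))
    have hA : ∀ q : ℕ × ℕ, 0 ≤ hrCoeffLo a b ℓ q.1 q.2 ∧ hrCoeffLo a b ℓ q.1 q.2 ≤ hrCoeff Δ ℓ q.1 q.2 ∧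
        hrCoeff Δ ℓ q.1 q.2 ≤ hrCoeffHi a b ℓ q.1 q.2 :=
      fun q => hrCoeff_mem_Icc_interval ha hΔ.1 hΔ.2 q.1 q.2
    -- diagonal entries: `X ≥ X_lo/λ`, `Y ≥ Y_lo/λ`
    have hXlo : headCellSumI ℓ a b F Φ₁lo / legendreLam ℓ ≤ X := by
      rw [headCellSumI, Finset.sum_div]
      refine Finset.sum_le_sum fun q hq => ?_
      have hmin := min_mul_le_mul_of_bounds (hA q).2.1 (hA q).2.2 ((hA q).1.trans (hA q).2.1)
        (hΦ₁ q hq Δ hΔ)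
      have hrw : c q * pointFunctional (w 0) z zb (crossF Δσ (-1) (zMono (Δ + (q.1 : ℝ)) q.2)) =
          hrCoeff Δ ℓ q.1 q.2 *
            pointFunctional (w 0) z zb (crossF Δσ (-1) (zMono (Δ + (q.1 : ℝ)) q.2)) /
              legendreLam ℓ := by
        simp only [hc]; ring
      rw [hrw]
      exact div_le_div_of_nonneg_right hmin hlam.le
    have hYlo : headCellSumI ℓ a b F Φ₂lo / legendreLam ℓ ≤ Y := by
      rw [headCellSumI, Finset.sum_div]
      refine Finset.sum_le_sum fun q hq => ?_
      have hmin := min_mul_le_mul_of_bounds (hA q).2.1 (hA q).2.2 ((hA q).1.trans (hA q).2.1)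
        (hΦ₂ q hq Δ hΔ)
      have hrw : c q * pointFunctional (w 1) z zb (crossF Δε (-1) (zMono (Δ + (q.1 : ℝ)) q.2)) =
          hrCoeff Δ ℓ q.1 q.2 *
            pointFunctional (w 1) z zb (crossF Δε (-1) (zMono (Δ + (q.1 : ℝ)) q.2)) /
              legendreLam ℓ := by
        simp only [hc]; ring
      rw [hrw]
      exact div_le_div_of_nonneg_right hmin hlam.le
    -- off-diagonal entry: `|W| ≤ Z_abs/λ`
    have hWabs : |W| ≤ headAbsSumI ℓ a b F Zabs / legendreLam ℓ := by
      rw [headAbsSumI, Finset.sum_div]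
      refine (Finset.abs_sum_le_sum_abs _ _).trans (Finset.sum_le_sum fun q hq => ?_)
      rw [abs_mul, abs_of_nonneg (div_nonneg ((hA q).1.trans (hA q).2.1) hlam.le)]
      have hZq := hZ q hq Δ hΔ
      have hZ0 : 0 ≤ Zabs q := (abs_nonneg _).trans hZq
      calc hrCoeff Δ ℓ q.1 q.2 / legendreLam ℓ * |_| ≤ hrCoeff Δ ℓ q.1 q.2 / legendreLam ℓ * Zabs q :=
            mul_le_mul_of_nonneg_left hZq (div_nonneg ((hA q).1.trans (hA q).2.1) hlam.le)
        _ ≤ hrCoeffHi a b ℓ q.1 q.2 * Zabs q / legendreLam ℓ := by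
            rw [div_mul_eq_mul_div]
            exact div_le_div_of_nonneg_right (mul_le_mul_of_nonneg_right (hA q).2.2 hZ0) hlam.le
    have hX0 : 0 ≤ headCellSumI ℓ a b F Φ₁lo / legendreLam ℓ := div_nonneg hX hlam.le
    have hY0 : 0 ≤ headCellSumI ℓ a b F Φ₂lo / legendreLam ℓ := div_nonneg hY hlam.le
    have hXpos : 0 ≤ X := hX0.trans hXlo
    have hYpos : 0 ≤ Y := hY0.trans hYlo
    refine quadForm_nonneg_of_det hXpos hYpos ?_ x y
    have hZabs0 : 0 ≤ headAbsSumI ℓ a b F Zabs / legendreLam ℓ := (abs_nonneg _).trans hWabs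
    have hW2 : W ^ 2 ≤ (headAbsSumI ℓ a b F Zabs / legendreLam ℓ) ^ 2 := by
      have h1 : -(headAbsSumI ℓ a b F Zabs / legendreLam ℓ) ≤ W := by
        linarith [neg_abs_le W]
      exact sq_le_sq' h1 ((le_abs_self W).trans hWabs)
    have hdet' : (headAbsSumI ℓ a b F Zabs / legendreLam ℓ) ^ 2 ≤
        4 * (headCellSumI ℓ a b F Φ₁lo / legendreLam ℓ) *
          (headCellSumI ℓ a b F Φ₂lo / legendreLam ℓ) := by
      rw [div_pow]
      have hre : 4 * (headCellSumI ℓ a b F Φ₁lo / legendreLam ℓ) *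
          (headCellSumI ℓ a b F Φ₂lo / legendreLam ℓ) =
          4 * headCellSumI ℓ a b F Φ₁lo * headCellSumI ℓ a b F Φ₂lo / legendreLam ℓ ^ 2 := by
        field_simp
      rw [hre]
      exact div_le_div_of_nonneg_right hdet (sq_nonneg _)
    calc W ^ 2 ≤ (headAbsSumI ℓ a b F Zabs / legendreLam ℓ) ^ 2 := hW2
      _ ≤ 4 * (headCellSumI ℓ a b F Φ₁lo / legendreLam ℓ) *
            (headCellSumI ℓ a b F Φ₂lo / legendreLam ℓ) := hdet'
      _ ≤ 4 * X * Y :=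
          mul_le_mul (mul_le_mul_of_nonneg_left hXlo (by norm_num)) hYlo hY0
            (mul_nonneg (by norm_num) hXpos)
  · intro q hq hr x y
    exact htail q hq hr (Δ + (q.1 : ℝ)) ⟨by linarith [hΔ.1], by linarith [hΔ.2]⟩ x y

/-- **Even head cell rule, half-open cell**: every `Δ ∈ [a, b)`, non-regular points by the limit
clause from the regular points to their right inside the cell.
[cite: KosPolandSimmonsduffin2014, §3.3 eq. (3.16)] -/
theorem evenPositive_ofPoints_of_headSumsI_Ico {N : ℕ} (z zb : Fin N → ℝ) (w : Fin 5 → Fin N → ℝ)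
    (hz : ∀ k, z k ∈ Ioo (0 : ℝ) 1) (hzb : ∀ k, zb k ∈ Ioo (0 : ℝ) 1) {ℓ : ℕ} {a b Δσ Δε : ℝ}
    (ha : unitarityBound3D ℓ < a) (F : Finset (ℕ × ℕ)) (Φ₁lo Φ₂lo Zabs : ℕ × ℕ → ℝ)
    (hΦ₁ : ∀ q ∈ F, ∀ Δ ∈ Icc a b,
      Φ₁lo q ≤ pointFunctional (w 0) z zb (crossF Δσ (-1) (zMono (Δ + (q.1 : ℝ)) q.2)))
    (hΦ₂ : ∀ q ∈ F, ∀ Δ ∈ Icc a b,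
      Φ₂lo q ≤ pointFunctional (w 1) z zb (crossF Δε (-1) (zMono (Δ + (q.1 : ℝ)) q.2)))
    (hZ : ∀ q ∈ F, ∀ Δ ∈ Icc a b,
      |pointFunctional (w 3) z zb (crossF ((Δσ + Δε) / 2) (-1) (zMono (Δ + (q.1 : ℝ)) q.2)) +
        pointFunctional (w 4) z zb (crossF ((Δσ + Δε) / 2) 1 (zMono (Δ + (q.1 : ℝ)) q.2))| ≤ Zabs q)
    (hX : 0 ≤ headCellSumI ℓ a b F Φ₁lo) (hY : 0 ≤ headCellSumI ℓ a b F Φ₂lo)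
    (hdet : headAbsSumI ℓ a b F Zabs ^ 2 ≤ 4 * headCellSumI ℓ a b F Φ₁lo * headCellSumI ℓ a b F Φ₂lo)
    (htail : ∀ q : ℕ × ℕ, q ∉ F → InDescendantRange ℓ q.1 q.2 →
      ∀ E ∈ Icc (a + q.1) (b + q.1), ∀ x y : ℝ, 0 ≤ evenTermForm z zb w Δσ Δε E q.2 x y) :
    ∀ Δ ∈ Ico a b, (CrossingFunctional.ofPoints z zb w).EvenPositive Δσ Δε Δ ℓ := by
  intro Δ hΔ
  have hreg := evenPositive_ofPoints_of_headSumsI z zb w hz hzb ha F Φ₁lo Φ₂lo Zabs hΦ₁ hΦ₂ hZ hX hY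
    hdet htail
  by_cases hr : IsRegularPoint3D Δ ℓ
  · exact hreg Δ ⟨hΔ.1, hΔ.2.le⟩ hr
  · have hbd : unitarityBound3D ℓ ≤ Δ := ha.le.trans hΔ.1
    refine evenPositive_ofPoints_of_eventually_right z zb w hz hzb Δσ Δε Δ ℓ hr ?_
    filter_upwards [eventually_isRegularPoint3D_nhdsGT_of_bound_le hbd, Ioo_mem_nhdsGT hΔ.2]
      with Δ' hΔ'reg hΔ'
    exact ⟨hΔ'reg, hreg Δ' ⟨hΔ.1.trans hΔ'.1.le, hΔ'.2.le⟩ hΔ'reg⟩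

/-! ### The cell numbers -/

/-- The off-diagonal term bound on a box: `max(|zm|, |zp|)` with the two two-weight corner bounds
`zm ≤ Φ⁴⁵ ≤ -zp`. [folklore] -/
def offDiagTermAbs {N : ℕ} (z zb : Fin N → ℝ) (w : Fin 5 → Fin N → ℝ) (j : ℕ)
    (E₁ E₂ slo shi : ℝ) : ℝ :=
  max |cornerBound₂ (w 3 + w 4) (w 3 - w 4) z zb j E₁ E₂ slo shi|
    |cornerBound₂ (-(w 3 + w 4)) (-(w 3 - w 4)) z zb j E₁ E₂ slo shi|

/-- `|Φ⁴⁵(E,j,s)| ≤ offDiagTermAbs` on the box. [folklore] -/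
theorem abs_sum45_le_offDiagTermAbs {N : ℕ} (z zb : Fin N → ℝ) (w : Fin 5 → Fin N → ℝ)
    (hz : ∀ k, z k ∈ Ioo (0 : ℝ) 1) (hzb : ∀ k, zb k ∈ Ioo (0 : ℝ) 1) (j : ℕ)
    {E₁ E₂ slo shi E s : ℝ} (hE : E ∈ Icc E₁ E₂) (hs : s ∈ Icc slo shi) :
    |pointFunctional (w 3) z zb (crossF s (-1) (zMono E j)) +
        pointFunctional (w 4) z zb (crossF s 1 (zMono E j))| ≤
      offDiagTermAbs z zb w j E₁ E₂ slo shi := by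
  rw [sum45_eq_twoWeightEval]
  set Z := twoWeightEval (w 3 + w 4) (w 3 - w 4) z zb s (zMono E j)
  have hlo : cornerBound₂ (w 3 + w 4) (w 3 - w 4) z zb j E₁ E₂ slo shi ≤ Z :=
    cornerBound₂_le _ _ z zb hz hzb j hE hs
  have hhi : Z ≤ -cornerBound₂ (-(w 3 + w 4)) (-(w 3 - w 4)) z zb j E₁ E₂ slo shi := by
    have h := cornerBound₂_le (-(w 3 + w 4)) (-(w 3 - w 4)) z zb hz hzb j hE hs
    rw [twoWeightEval_neg] at h
    linarith
  unfold offDiagTermAbs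
  rw [abs_le]
  constructor
  · have : -|cornerBound₂ (w 3 + w 4) (w 3 - w 4) z zb j E₁ E₂ slo shi| ≤
        cornerBound₂ (w 3 + w 4) (w 3 - w 4) z zb j E₁ E₂ slo shi := neg_abs_le _
    linarith [le_max_left |cornerBound₂ (w 3 + w 4) (w 3 - w 4) z zb j E₁ E₂ slo shi|
      |cornerBound₂ (-(w 3 + w 4)) (-(w 3 - w 4)) z zb j E₁ E₂ slo shi|]
  · have : -cornerBound₂ (-(w 3 + w 4)) (-(w 3 - w 4)) z zb j E₁ E₂ slo shi ≤
        |cornerBound₂ (-(w 3 + w 4)) (-(w 3 - w 4)) z zb j E₁ E₂ slo shi| := by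
      rw [← abs_neg]; exact le_abs_self _
    linarith [le_max_right |cornerBound₂ (w 3 + w 4) (w 3 - w 4) z zb j E₁ E₂ slo shi|
      |cornerBound₂ (-(w 3 + w 4)) (-(w 3 - w 4)) z zb j E₁ E₂ slo shi|]

/-- The three numbers of an even head cell on the canonical head set: `X_lo` (`σ`-row, corner term
bounds on `[σ_lo,σ_hi]`), `Y_lo` (`ε`-row, on `[ε_lo,ε_hi]`), `Z_abs` (off-diagonal, on the `s`-box
`[(σ_lo+ε_lo)/2, (σ_hi+ε_hi)/2]`). [cite: KosPolandSimmonsduffin2014, §3.3 eq. (3.16)] -/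
def evenHeadX {N : ℕ} (z zb : Fin N → ℝ) (w : Fin 5 → Fin N → ℝ) (ℓ : ℕ) (a b σlo σhi : ℝ)
    (nF : ℕ) : ℝ :=
  headCellSumI ℓ a b (headSet ℓ nF)
    (fun q => termCornerBound (w 0) z zb q.2 (a + q.1) (b + q.1) σlo σhi)

/-- See `evenHeadX`. [cite: KosPolandSimmonsduffin2014, §3.3 eq. (3.16)] -/
def evenHeadY {N : ℕ} (z zb : Fin N → ℝ) (w : Fin 5 → Fin N → ℝ) (ℓ : ℕ) (a b εlo εhi : ℝ)
    (nF : ℕ) : ℝ :=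
  headCellSumI ℓ a b (headSet ℓ nF)
    (fun q => termCornerBound (w 1) z zb q.2 (a + q.1) (b + q.1) εlo εhi)

/-- See `evenHeadX`. [cite: KosPolandSimmonsduffin2014, §3.3 eq. (3.16)] -/
def evenHeadZ {N : ℕ} (z zb : Fin N → ℝ) (w : Fin 5 → Fin N → ℝ) (ℓ : ℕ)
    (a b σlo σhi εlo εhi : ℝ) (nF : ℕ) : ℝ :=
  headAbsSumI ℓ a b (headSet ℓ nF)
    (fun q => offDiagTermAbs z zb w q.2 (a + q.1) (b + q.1) ((σlo + εlo) / 2) ((σhi + εhi) / 2))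

/-- **One even light-block cell from its three numbers.** In the dominated configuration
(apex `a₀`), for `(Δ_σ, Δ_ε) ∈ Q ⊆ [σ_lo,σ_hi] × [ε_lo,ε_hi]`, with the even tail rules in force —
(M) boxes on `[E₀, E_T)` (`hM`, e.g. from `evenTermForm_nonneg_of_cornerBounds`) and the (T) apex
numbers `hX0, hY0, hZ0` of `tail_evenPositive_of_boxes_and_apex` —, a `Δ`-cell `[a, b)` starting
strictly above the unitarity bound with `a ≥ ℓ + τ`, head level `n_F` with `a + n_F + 1 ≥ E₀`, and
`X_lo ≥ 0`, `Y_lo ≥ 0`, `Z_abs² ≤ 4 X_lo Y_lo` give `EvenPositive` for every `p ∈ Q` at every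
`Δ ∈ [a, b)`. Obligations (E2)–(E4) are finite unions of such cells.
[cite: KosPolandSimmonsduffin2014, §3.3 eq. (3.16)] -/
theorem evenCell_of_headNumbers {N : ℕ} (z zb : Fin N → ℝ) (w : Fin 5 → Fin N → ℝ)
    (hz : ∀ k, z k ∈ Ioo (0 : ℝ) 1) (hzb : ∀ k, zb k ∈ Ioo (0 : ℝ) 1) (hord : ∀ k, zb k ≤ z k)
    (a₀ : Fin N) (qd qr : Fin N → ℝ) (hqd : ∀ k, 0 < qd k ∧ qd k ≤ 1)
    (hqr : ∀ k, 0 < qr k ∧ qr k ≤ 1)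
    (hdomd : ∀ k, z k * zb k ≤ qd k ^ 2 * (z a₀ * zb a₀) ∧ z k ≤ qd k * z a₀)
    (hdomr : ∀ k, (1 - z k) * (1 - zb k) ≤ qr k ^ 2 * (z a₀ * zb a₀) ∧ 1 - zb k ≤ qr k * z a₀)
    {Q : Set (ℝ × ℝ)} {σlo σhi εlo εhi E₀ ET τ : ℝ}
    (hQ : ∀ p ∈ Q, (σlo ≤ p.1 ∧ p.1 ≤ σhi) ∧ (εlo ≤ p.2 ∧ p.2 ≤ εhi))
    (hM : ∀ (j : ℕ) (E : ℝ), E₀ ≤ E → E < ET → (j : ℝ) + τ ≤ E → ∀ p ∈ Q,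
      ∀ x y : ℝ, 0 ≤ evenTermForm z zb w p.1 p.2 E j x y)
    (h0 : 0 ≤ w 0 a₀) (h1 : 0 ≤ w 1 a₀)
    (hX0 : 0 ≤ w 0 a₀ * ((1 - z a₀) * (1 - zb a₀)) ^ σhi - apexRest (w 0) z zb a₀ qd qr σlo ET)
    (hY0 : 0 ≤ w 1 a₀ * ((1 - z a₀) * (1 - zb a₀)) ^ εhi - apexRest (w 1) z zb a₀ qd qr εlo ET)
    (hZ0 : (|w 3 a₀ + w 4 a₀| * ((1 - z a₀) * (1 - zb a₀)) ^ ((σlo + εlo) / 2)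
            + apexRest (w 3) z zb a₀ qd qr ((σlo + εlo) / 2) ET
            + apexRest (w 4) z zb a₀ qd qr ((σlo + εlo) / 2) ET) ^ 2 ≤
        4 * (w 0 a₀ * ((1 - z a₀) * (1 - zb a₀)) ^ σhi - apexRest (w 0) z zb a₀ qd qr σlo ET) *
          (w 1 a₀ * ((1 - z a₀) * (1 - zb a₀)) ^ εhi - apexRest (w 1) z zb a₀ qd qr εlo ET))
    {ℓ : ℕ} {a b : ℝ} (ha : unitarityBound3D ℓ < a) (haτ : (ℓ : ℝ) + τ ≤ a) (nF : ℕ)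
    (hnF : E₀ ≤ a + ((nF : ℝ) + 1))
    (hX : 0 ≤ evenHeadX z zb w ℓ a b σlo σhi nF) (hY : 0 ≤ evenHeadY z zb w ℓ a b εlo εhi nF)
    (hdet : evenHeadZ z zb w ℓ a b σlo σhi εlo εhi nF ^ 2 ≤
      4 * evenHeadX z zb w ℓ a b σlo σhi nF * evenHeadY z zb w ℓ a b εlo εhi nF) :
    ∀ p ∈ Q, ∀ Δ ∈ Ico a b, (CrossingFunctional.ofPoints z zb w).EvenPositive p.1 p.2 Δ ℓ := by
  intro p hp
  have hT := evenTermForm_nonneg_of_apex z zb w hz hzb hord a₀ qd qr hqd hqr hdomd hdomr h0 h1 hX0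
    hY0 hZ0
  refine evenPositive_ofPoints_of_headSumsI_Ico z zb w hz hzb ha (headSet ℓ nF) _ _ _ ?_ ?_ ?_ hX hY
    hdet ?_
  · intro q _ Δ hΔ
    exact termCornerBound_le (w 0) z zb hz hzb q.2
      (⟨by linarith [hΔ.1], by linarith [hΔ.2]⟩ : Δ + (q.1 : ℝ) ∈ Icc (a + q.1) (b + q.1))
      ⟨(hQ p hp).1.1, (hQ p hp).1.2⟩
  · intro q _ Δ hΔ
    exact termCornerBound_le (w 1) z zb hz hzb q.2
      (⟨by linarith [hΔ.1], by linarith [hΔ.2]⟩ : Δ + (q.1 : ℝ) ∈ Icc (a + q.1) (b + q.1))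
      ⟨(hQ p hp).2.1, (hQ p hp).2.2⟩
  · intro q _ Δ hΔ
    exact abs_sum45_le_offDiagTermAbs z zb w hz hzb q.2
      (⟨by linarith [hΔ.1], by linarith [hΔ.2]⟩ : Δ + (q.1 : ℝ) ∈ Icc (a + q.1) (b + q.1))
      ⟨by linarith [(hQ p hp).1.1, (hQ p hp).2.1], by linarith [(hQ p hp).1.2, (hQ p hp).2.2]⟩
  · intro q hq hr E hE x y
    have h2 : (q.2 : ℝ) ≤ (ℓ : ℝ) + q.1 := by exact_mod_cast hr.2.1
    have hjb : (q.2 : ℝ) + τ ≤ E := by linarith [hE.1]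
    have hjE : (q.2 : ℝ) ≤ E := by
      linarith [hE.1, natCast_add_half_le_unitarityBound3D ℓ]
    have hE0 : E₀ ≤ E := (headSet_off hnF q hq hr).trans hE.1
    by_cases hET : E < ET
    · exact hM q.2 E hE0 hET hjb p hp x y
    · exact hT E (not_lt.1 hET) q.2 hjE p.1 ⟨(hQ p hp).1.1, (hQ p hp).1.2⟩ p.2
        ⟨(hQ p hp).2.1, (hQ p hp).2.2⟩ x y

/-- **A covered range from cells** (even sector): half-open cells `[t_i, t_{i+1})`, `i < m`, with
`t_0 ≤ lo`, `hi ≤ t_m`, each carrying `EvenPositive` on `Q`, cover every `Δ ∈ [lo, hi)`. [folklore] -/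
theorem evenPositive_of_cells {N : ℕ} (z zb : Fin N → ℝ) (w : Fin 5 → Fin N → ℝ)
    {Q : Set (ℝ × ℝ)} {ℓ : ℕ} (t : ℕ → ℝ) (m : ℕ) {lo hi : ℝ}
    (hlo : t 0 ≤ lo) (hhi : hi ≤ t m)
    (hcell : ∀ i < m, ∀ p ∈ Q, ∀ Δ ∈ Ico (t i) (t (i + 1)),
      (CrossingFunctional.ofPoints z zb w).EvenPositive p.1 p.2 Δ ℓ) :
    ∀ p ∈ Q, ∀ Δ : ℝ, lo ≤ Δ → Δ < hi →
      (CrossingFunctional.ofPoints z zb w).EvenPositive p.1 p.2 Δ ℓ := by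
  intro p hp Δ h1 h2
  have hΔm : Δ < t m := lt_of_lt_of_le h2 hhi
  have h0 : t 0 ≤ Δ := hlo.trans h1
  have hex : ∃ i, i < m ∧ t i ≤ Δ ∧ Δ < t (i + 1) := by
    by_contra hne
    push Not at hne
    have key : ∀ i, i ≤ m → t i ≤ Δ := by
      intro i
      induction i with
      | zero => intro _; exact h0
      | succ i ih =>
        intro hi'
        exact hne i (by omega) (ih (by omega))
    exact absurd (key m le_rfl) (not_le.2 hΔm)
  obtain ⟨i, him, hi1, hi2⟩ := hex
  exact hcell i him p hp Δ ⟨hi1, hi2⟩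

end Literature.MathematicalPhysics.QuantumFieldTheory.ConformalBootstrap3D
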